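import Literature.MathematicalPhysics.QuantumFieldTheory.Dimock2011to13.QED3SingleScaleTheorem1
import Literature.MathematicalPhysics.QuantumFieldTheory.Dimock2011to13.QED3SquarePartitionOfUnity
import HarnessLib

/-!
# Dimock, *QED on the 3-torus. II*, §3.2 THEOREM 1 proof PART I, the LOCALITY of the walk expansion: «the term vanishes
# unless all pairs `□_j, □_{j+1}` are adjacent. The kernel `S_{k,Λ,ω}(A,x,y)` vanishes unless `x ∈ supp h_{□_0} ⊂ □̃_0` and
# `y ∈ supp h_{□_n} ⊂ □̃_n`» (p.23 L54–56), «`h_□h_□′ = 0` unless `□, □′` touch» (p.21 L10) — the OPERATOR SUPPORT FACTS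
# of the tree's `dimock_thm1` ∕ `dimock_thm1_lattice` PROVED for multiplication operators `h_□` supported near the cube
# centres and an operator of finite range; THEOREM 1 (single scale) with `h_□ :=` the printed (124)

statement-level skeleton of published theorems with citation tags; proofs where landed; nothing here is a claim about the Yang–Mills mass gap

**Citation header (reproduction of PUBLISHED work).** J. Dimock, *Quantum electrodynamics on the 3-torus. II. The
renormalization group flow*, arXiv:math-ph/0407063 (2004) [Dimock2004QED3TorusII], **§3.1** (124)–(126) p.20 L82 – p.21
L15 and **§3.2 THEOREM 1** (132)–(135) p.22 L2–23 with its proof **Part I** (138)–(142) p.23 L1–58, of the held arXiv text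
layer `paper:arxiv-math-ph_0407063` (`p.NN Lnn` = PDF page ∕ text-layer line).  Writer seat p11
(literature-prover-lit-balaban-p11-g24-0), YM LIT SWEEP item (c) D13 (row C13 «WHERE»; zero weight for the YM-INPRINT
tokens).  Imports the tree's `QED3SingleScaleTheorem1` (`dimock_thm1_lattice`; through it `QED3WalkExpansionInverse`:
`link0`, `linkR`, `chainProd`, `Kz`) and `QED3SquarePartitionOfUnity` (`hBlock`, `hBlock_eq_zero`).

**The printed text.**  p.20 L82 – p.21 L15: *"First take a smooth function `g` on `ℝ³` so `g` has support in
`{x : |x| ≤ 2∕3}` … we define `h_□(x) = g((x − y)L^{k−i}∕M₀)` (124) … `Σ_{□∈D}h_□(x)² = 1` (125) … Note that `h_□h_□′ = 0`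
unless `□, □′` touch. We also define some enlargements of each `L^{−(k−i)}M₀` cube `□ ∈ D_i`. We set `□̃ = 3M₀L^{−(k−i)}`
cube centered on `□` … (126) … We have `supp h_□ ⊂ □̃`."*  p.22 L7–11: *"Here we are summing over paths `ω` each of which
is a sequence of adjacent cubes (blocks) `□_0,…,□_n` from `D`. … the adjacency condition is that `□_j, □_{j+1}` should
touch, possibly only on corners, and including the possibility `□_j = □_{j+1}`. The notation `ω : x → y` means `x ∈ □̃_0`,
`y ∈ □̃_n`."*  p.23 L18–25, (140): *"`R_□(A) = −[(D_{e_k}(A) + m_k + Q_{k,Λ}(−A)ᵀbQ_{k,Λ}(A)), h_□]`"*; p.23 L54–56: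
*"In the last step we identify the random walk expansion by noting that the term vanishes unless all pairs `□_j, □_{j+1}`
are adjacent. The kernel `S_{k,Λ,ω}(A,x,y)` vanishes unless `x ∈ supp h_{□_0} ⊂ □̃_0` and `y ∈ supp h_{□_n} ⊂ □̃_n`."*
The operator `D_{e_k}(A) + m_k + Qᵀ_{k,Λ}bQ_{k,Λ}` couples nearest neighbours ((144) p.23 L73–80: *"where the sum is over
nearest neighbors `x′` of `x`"*) and points of a common `L^{−(k−i)}` block ((146)–(147) p.23 L89 – p.24 L9:
`χ(|x′ − [x]| ≤ L^{−(k−i)}∕2)`), i.e. it has FINITE RANGE `≤ L^{−(k−i)} = M₀^{−1}×(cube side)`.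

**What is formalized (kernel-checked, zero `sorry`, no named facts).**  In the tree's `dimock_thm1` (THEOREM 1 assembled)
and `dimock_thm1_lattice` (its single-scale member with the geometry concrete) the supports of the walk
expansion are HYPOTHESIS: `hadj : ¬adj □ □′ → h_□R_{□′} = 0`, the start-cube supports `hS₀`, `hS₁` of the two kinds of
links at a site and their nearness `hS₀near`, `hS₁near`.  Here they are PROVED from the printed mechanism:
* §1 (any ring) — for MULTIPLICATION OPERATORS `H □ = diagonal(h_□)`: the entries `(h_□R_{□′})(x,y) =
  h_□(x)·(h_{□′}(x)A(x,y) − A(x,y)h_{□′}(y))` (`H_mul_Kz_apply`; `R_{□′} = Kz A H □′ = h_{□′}A − Ah_{□′}`), of the first link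
  `(h_□S*_□h_□)(x,v) = h_□(x)S*_□(x,v)h_□(v)` (`link0_apply`) and of the later links (`linkR_apply`); hence
  `h_□R_{□′} = 0` as soon as no coupled pair `A(x,y) ≠ 0` has `x ∈ supp h_□` and `x` or `y` in `supp h_{□′}`
  (`H_mul_Kz_eq_zero`), «`h_□h_□′ = 0`» for disjoint supports (`H_mul_H_eq_zero`), the `x`-rows of both links vanish off
  `supp h_□` resp. off its `A`-neighbourhood (`link0_eq_zero_of_apply`, `linkR_eq_zero_of`), and **«`S_{k,Λ,ω}(A,x,y)`
  vanishes unless `y ∈ supp h_{□_n}`»** (`chainProd_apply_eq_zero_of_last`; the `x`-half is the tree's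
  `chainProd_apply_eq_zero_of_row`).
* §2 (sup metric of paper I on positions `pos : X → ℝ^ι`, cube centres on the lattice `c₀ + Mℤ^ι` indexed by
  `cidx : Z → ℤ^ι`) — if `supp h_□ ⊂ {‖pos x − centre(□)‖ ≤ R}` («`supp h_□ ⊂ □̃`») and `A(x,y) ≠ 0 ⟹ ‖pos x − pos y‖ ≤ ρ`,
  then `2R + ρ < 2M` gives **`h_□R_{□′} = 0` unless `supDist (cidx □) (cidx □′) ≤ 1`** — the printed *"touch, possibly only
  on corners, … including `□_j = □_{j+1}`"* (`H_mul_Kz_eq_zero_of_far`), `R < M` gives **«`h_□h_□′ = 0` unless `□, □′`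
  touch»** (`H_mul_H_eq_zero_of_far`), both links at a site `x` vanish unless `□` is within index distance `1` of the cube of
  `x` (rounding, `norm_sub_round_le`; `link0_eq_zero_of_far`, `linkR_eq_zero_of_far`), and **«`ω : x → y` means `x ∈ □̃_0`,
  `y ∈ □̃_n`»**: `S_ω(x,y) ≠ 0 ⟹ ‖pos x − centre(□_0)‖ ≤ R ∧ ‖pos y − centre(□_n)‖ ≤ R` (`chainProd_ne_zero_endpoints`).
* §3 **`dimock_thm1_supported`**: the tree's `dimock_thm1_lattice` (THEOREM 1 (132)–(135), single scale, Remark 3) with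
  `adj := (supDist (cidx □) (cidx □′) ≤ 1)` and the hypotheses `hadj`, `S₀`, `hS₀`, `hS₀near`, `S₁`, `hS₁`, `hS₁near`
  DISCHARGED from: `H □ = diagonal(h_□)`, `supp h_□` within sup-radius `R` of the centre, `A` of range `ρ ≥ 0`,
  `2R + ρ < 2M`, `R + ρ < 3M∕2`.
* §4 **`dimock_thm1_hBlock`**: the same with **`h_□ :=` the printed (124)**, `h_□(x) = g(M^{−1}(pos x − centre(□)))` =
  the tree's `QED3SquarePartition.hBlock M⁻¹ centre(□)` (the CONSTRUCTED `g` of `QED3SquarePartitionOfUnity`: support in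
  the sup-ball of radius `2∕3`, so `R = 2M∕3` by `hBlock_eq_zero` — `norm_le_of_hBlock_ne_zero`, `hBlock_support`), AND
  **(125) `Σ_□h_□² = 1` DERIVED** on the finite site set from the tree's `eq125` when every site is *"well inside"* the cube
  array (`hcover`: each lattice cube with centre within `2M∕3` of a site is a cube of `Z`; `sum_hBlock_sq_eq_one`,
  `h125_hBlock`); the range condition becomes `ρ < 2M∕3` — with `ρ = L^{−(k−i)}` and `M = M₀L^{−(k−i)}` this is
  `M₀ > 3∕2`, a case of *"Let `M₀` be sufficiently large"* (p.22 L16).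
Conclusions as in `dimock_thm1`: every entry series `Σ_n(S*Rⁿ)(x,y)` converges, `A·S_{k,Λ}(A) = 1`, and (135)
`‖S_{k,Λ}(A;x,y)‖ ≤ 2·3^{|ι|}·C₀e^{3cw′h}·P₀(x,y)e^{−(c∕2)d(x,y)}`.
* §5 (v1.1) **the `A`-DEPENDENCE CLAUSE of THEOREM 1** (p.22 L22–23: *"`S_{k,Λ,ω}(A)` depends on `A` only in
  `⋃_{□∈ω}□^{(5)}`"*) — `Kz_congr` (`R_□(A)` sees `A` only at entries touching `supp h_□`), `linkR_congr`,
  `link0_congr_of_eq`, **`chainProd_congr_of_agree`**: `S_{k,Λ,ω}(A) = S_{k,Λ,ω}(A′)` when the local inverses of the cubes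
  of `ω` agree (LEMMA 2's locality «`S*_□(A)` depends on `A` in `□^{(5)}`» as the hypothesis) and `A`, `A′` agree at the
  entries touching `⋃_j supp h_{□_j} ⊂ ⋃_j□̃_j`; `chainProd_hBlock_congr` (the same with `h_□ :=` the printed (124):
  entries with `pos x` or `pos y` within `2M∕3` of a centre of `ω`).

**Honest scope.**  What REMAINS hypothesis in §3–§4 is the printed analytic input only: (125) `Σ_□h_□² = 1` in §3 (in §4
it is derived for sites well inside a single-scale cube array; the multiscale family `D` with its boundary-face
modification, p.21 L5–9, is not treated), (136) and the link bounds (137) ∕ (143) (LEMMA 2, Part II — the tree's `QED3CommutatorBounds` gives (143) from kernel shapes),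
the block convolution bounds (154) (`hconv`, `hconv₀`; on `ℤ³` the tree's `hconv_Z3`), and the finite range of
`D_{e_k}(A) + m_k + QᵀbQ` (read off (144), (146)–(147); the operators themselves are not constructed here).  The
positions `pos` are free (any map to `ℝ^ι`; in the application `pos = L^{−k}e`); the boundary-face modification of
`h_□` between scales (p.21 L5–9) only changes the support radius `R`, which §3 keeps abstract.  As in
`dimock_thm1_lattice`, cubes are indexed in `ℤ^ι` and sites positioned in `ℝ^ι` WITHOUT periodic identification (a box
geometry): on the full tori of Remark 3 the range, support and adjacency conditions refer to the periodic sup-distance,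
which is not set up here.  Single scale only.  In §5 LEMMA 2's own locality («`S*_□(A)` depends on `A` in `□^{(5)}`»,
from the construction (156)–(177)) is a HYPOTHESIS (`hG`), not proved.  No `d = 4` statement; nothing about Bałaban's
papers.

**Version.**  v1.1 — ADDITIVE to v1 (p354743, commit f51b8a0aae6d): + §5 (`Kz_congr`, `link0_congr_of_eq`,
`linkR_congr`, `chainProd_congr_of_agree`, `chainProd_hBlock_congr`); every v1 declaration byte-identical.
-/

noncomputable section

namespace Literature.MathematicalPhysics.QuantumFieldTheory.Dimock2011to13

namespace QED3TorusII

open Finset Real QED3PathMetric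
open RandomWalkExpansion (Kz Gstar Kop)

/-! ## §1 Multiplication operators: the entries of `h_□R_{□′}`, `h_□S*_□h_□`, `R_□S*_□h_□` -/

section MulOps

variable {X : Type*} [Fintype X] [DecidableEq X] {E : Type*} [Ring E]
variable {Z : Type*} {φ : Z → X → E} {H : Z → Matrix X X E}

/-- the commutator link `R_{□} = h_□A − Ah_□` (the tree's `Kz`; (140) up to the sign convention `R_□ = −[A,h_□]`) of a
MULTIPLICATION operator `h_□` has entries `h_□(x)A(x,y) − A(x,y)h_□(y)`.
[cite: Dimock2004QED3TorusII, §3.2 Thm 1 proof Part I (140) p.23 L18–25] -/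
theorem Kz_apply (hH : ∀ z, H z = Matrix.diagonal (φ z)) (A : Matrix X X E) (z : Z) (x y : X) :
    Kz A H z x y = φ z x * A x y - A x y * φ z y := by
  show (H z * A - A * H z) x y = _
  rw [hH z, Matrix.sub_apply, Matrix.diagonal_mul, Matrix.mul_diagonal]

/-- **the junction entries**: `(h_□R_{□′})(x,y) = h_□(x)·(h_{□′}(x)A(x,y) − A(x,y)h_{□′}(y))`.
[cite: Dimock2004QED3TorusII, §3.2 Thm 1 proof Part I (140)–(142) p.23 L18–56] -/
theorem H_mul_Kz_apply (hH : ∀ z, H z = Matrix.diagonal (φ z)) (A : Matrix X X E) (z z' : Z) (x y : X) :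
    (H z * Kz A H z') x y = φ z x * (φ z' x * A x y - A x y * φ z' y) := by
  rw [hH z, Matrix.diagonal_mul, Kz_apply hH]

/-- **`h_□R_{□′} = 0`** as soon as every coupled pair `A(x,y) ≠ 0` with `x ∈ supp h_□` has `x, y ∉ supp h_{□′}` — the
mechanism behind *"the term vanishes unless all pairs `□_j, □_{j+1}` are adjacent"*.
[cite: Dimock2004QED3TorusII, §3.2 Thm 1 proof Part I p.23 L54–55] -/
theorem H_mul_Kz_eq_zero (hH : ∀ z, H z = Matrix.diagonal (φ z)) {A : Matrix X X E} {z z' : Z}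
    (hvan : ∀ x y, φ z x ≠ 0 → A x y ≠ 0 → φ z' x = 0 ∧ φ z' y = 0) : H z * Kz A H z' = 0 := by
  ext x y
  rw [H_mul_Kz_apply hH, Matrix.zero_apply]
  by_cases hx : φ z x = 0
  · rw [hx, zero_mul]
  by_cases hA : A x y = 0
  · rw [hA, mul_zero, zero_mul, sub_self, mul_zero]
  obtain ⟨h1, h2⟩ := hvan x y hx hA
  rw [h1, h2, zero_mul, mul_zero, sub_self, mul_zero]

/-- **«`h_□h_□′ = 0` unless `□, □′` touch»**: multiplication operators with disjoint supports have product zero.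
[cite: Dimock2004QED3TorusII, §3.1 p.21 L10] -/
theorem H_mul_H_eq_zero (hH : ∀ z, H z = Matrix.diagonal (φ z)) {z z' : Z}
    (hdisj : ∀ x, φ z x = 0 ∨ φ z' x = 0) : H z * H z' = 0 := by
  ext x y
  rw [hH z, hH z', Matrix.diagonal_mul_diagonal, Matrix.zero_apply, Matrix.diagonal_apply]
  split_ifs with h
  · rcases hdisj x with h0 | h0
    · rw [h0, zero_mul]
    · rw [h0, mul_zero]
  · rfl

/-- the entries of the first link `h_□S*_□(A)h_□`: `h_□(x)S*_□(x,v)h_□(v)`.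
[cite: Dimock2004QED3TorusII, §3.2 Thm 1 proof Part I (138), (142) p.23 L3–8, L31–53] -/
theorem link0_apply (hH : ∀ z, H z = Matrix.diagonal (φ z)) (G : Z → Matrix X X E) (z : Z) (x v : X) :
    link0 H G z x v = φ z x * G z x v * φ z v := by
  show (H z * G z * H z) x v = _
  rw [hH z, Matrix.mul_diagonal, Matrix.diagonal_mul]

/-- the `x`-row of the first link vanishes off `supp h_□` (*"vanishes unless `x ∈ supp h_{□_0}`"*).
[cite: Dimock2004QED3TorusII, §3.2 Thm 1 proof Part I p.23 L55–56] -/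
theorem link0_eq_zero_of_apply (hH : ∀ z, H z = Matrix.diagonal (φ z)) (G : Z → Matrix X X E) {z : Z} {x : X}
    (hx : φ z x = 0) (v : X) : link0 H G z x v = 0 := by
  rw [link0_apply hH, hx, zero_mul, zero_mul]

/-- the `y`-column of the first link vanishes off `supp h_□`.
[cite: Dimock2004QED3TorusII, §3.2 Thm 1 proof Part I p.23 L55–56] -/
theorem link0_eq_zero_of_apply_right (hH : ∀ z, H z = Matrix.diagonal (φ z)) (G : Z → Matrix X X E) {z : Z}
    {y : X} (hy : φ z y = 0) (u : X) : link0 H G z u y = 0 := by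
  rw [link0_apply hH, hy, mul_zero]

/-- the entries of a later link `R_□S*_□(A)h_□`: `Σ_u(h_□(x)A(x,u) − A(x,u)h_□(u))S*_□(u,v)h_□(v)`.
[cite: Dimock2004QED3TorusII, §3.2 Thm 1 proof Part I (139)–(142) p.23 L9–53] -/
theorem linkR_apply (hH : ∀ z, H z = Matrix.diagonal (φ z)) (A : Matrix X X E) (G : Z → Matrix X X E) (z : Z)
    (x v : X) : linkR A H G z x v = (∑ u, (φ z x * A x u - A x u * φ z u) * G z u v) * φ z v := by
  show (Kz A H z * G z * H z) x v = _
  rw [hH z, Matrix.mul_diagonal, Matrix.mul_apply]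
  simp_rw [Kz_apply hH]

/-- the `y`-column of a later link vanishes off `supp h_□` (the link ends with the factor `h_□`).
[cite: Dimock2004QED3TorusII, §3.2 Thm 1 proof Part I (142) p.23 L31–56] -/
theorem linkR_eq_zero_of_apply_right (hH : ∀ z, H z = Matrix.diagonal (φ z)) (A : Matrix X X E)
    (G : Z → Matrix X X E) {z : Z} {y : X} (hy : φ z y = 0) (u : X) : linkR A H G z u y = 0 := by
  rw [linkR_apply hH, hy, mul_zero]

/-- the `x`-row of a later link `R_□S*_□h_□` vanishes when `x ∉ supp h_□` and no `A`-neighbour of `x` lies in `supp h_□`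
(then the `x`-row of `R_□ = h_□A − Ah_□` is zero). [cite: Dimock2004QED3TorusII, §3.2 Thm 1 proof Part I (140)–(142) p.23 L18–56] -/
theorem linkR_eq_zero_of (hH : ∀ z, H z = Matrix.diagonal (φ z)) {A : Matrix X X E} (G : Z → Matrix X X E) {z : Z}
    {x : X} (hx : φ z x = 0) (hnear : ∀ u, A x u ≠ 0 → φ z u = 0) (v : X) : linkR A H G z x v = 0 := by
  rw [linkR_apply hH]
  have h0 : ∀ u, (φ z x * A x u - A x u * φ z u) * G z u v = 0 := by
    intro u
    rw [hx, zero_mul, zero_sub]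
    by_cases hA : A x u = 0
    · rw [hA, zero_mul, neg_zero, zero_mul]
    · rw [hnear u hA, mul_zero, neg_zero, zero_mul]
  rw [sum_eq_zero fun u _ => h0 u, zero_mul]

end MulOps

section ChainEnds

variable {X : Type*} [Fintype X] [DecidableEq X] {E : Type*} [NormedRing E]
variable {Z : Type*} {φ : Z → X → E} {H : Z → Matrix X X E}

omit [DecidableEq X] in
/-- a matrix product has a zero `y`-column if its right factor has. [folklore] -/
private theorem mul_apply_eq_zero_of_col {M N : Matrix X X E} {y : X} (h : ∀ w, N w y = 0) (x : X) :
    (M * N) x y = 0 := by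
  rw [Matrix.mul_apply]
  exact sum_eq_zero fun w _ => by rw [h w, mul_zero]

/-- **«the kernel `S_{k,Λ,ω}(A,x,y)` vanishes unless `y ∈ supp h_{□_n}`»**: the path operator
`S_ω = (h_{□_0}S*_{□_0}h_{□_0})(R_{□_1}S*_{□_1}h_{□_1})⋯(R_{□_n}S*_{□_n}h_{□_n})` (the tree's `chainProd`) ends with the
factor `h_{□_n}`, so its `y`-column vanishes where `h_{□_n}(y) = 0` (the `x`-half is the tree's
`chainProd_apply_eq_zero_of_row`). [cite: Dimock2004QED3TorusII, §3.2 Thm 1 proof Part I (142) p.23 L31–56] -/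
theorem chainProd_apply_eq_zero_of_last (hH : ∀ z, H z = Matrix.diagonal (φ z)) (A : Matrix X X E)
    (G : Z → Matrix X X E) {n : ℕ} (ω : Fin (n + 1) → Z) (x : X) {y : X} (hy : φ (ω (Fin.last n)) y = 0) :
    chainProd A H G ω x y = 0 := by
  unfold chainProd
  cases n with
  | zero =>
      rw [List.ofFn_zero, List.prod_nil, mul_one]
      exact link0_eq_zero_of_apply_right hH G hy x
  | succ m =>
      rw [List.ofFn_succ', List.prod_concat, ← mul_assoc]
      refine mul_apply_eq_zero_of_col (fun w => ?_) x
      rw [Fin.succ_last]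
      exact linkR_eq_zero_of_apply_right hH A G hy w

end ChainEnds

/-! ## §2 Supports near the cube centres and an operator of finite range: adjacency = index sup-distance `≤ 1` -/

section Supports

variable {ι : Type*} [Fintype ι]

/-- integer vectors whose real images are coordinatewise `< 2` apart are within `supDist ≤ 1`.
[cite: Dimock2004QED3TorusII, §3.2 (132) p.22 L7–11 («touch, possibly only on corners, and including the possibility □_j = □_{j+1}»)] -/
theorem supDist_le_one_of_abs_lt_two {a b : ι → ℤ} (h : ∀ μ, |(a μ : ℝ) - (b μ : ℝ)| < 2) : supDist a b ≤ 1 := by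
  rw [supDist_le_iff]
  intro μ
  have h1 : (((a μ - b μ).natAbs : ℕ) : ℝ) < 2 := by
    rw [Nat.cast_natAbs, Int.cast_abs, Int.cast_sub]
    exact h μ
  have h2 : (a μ - b μ).natAbs < 2 := by exact_mod_cast h1
  omega

/-- **the witness lemma**: two lattice centres `c₀ + Ma`, `c₀ + Mb` seen from points `p`, `q` within `R₁`, `R₂` of them and
within `ρ` of each other, `R₁ + ρ + R₂ < 2M`, have indices at sup-distance `≤ 1` (sup metric `‖·‖` of `ℝ^ι`, paper I (21)).
[cite: Dimock2004QED3TorusII, §3.1 (126) p.21 L11–15 and §3.2 (132) p.22 L7–11] -/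
theorem supDist_le_one_of_witness {c₀ : ι → ℝ} {M R₁ R₂ ρ : ℝ} (hM : R₁ + ρ + R₂ < 2 * M) {a b : ι → ℤ}
    {p q : ι → ℝ} (hp : ‖p - (c₀ + M • fun μ => (a μ : ℝ))‖ ≤ R₁) (hpq : ‖p - q‖ ≤ ρ)
    (hq : ‖q - (c₀ + M • fun μ => (b μ : ℝ))‖ ≤ R₂) : supDist a b ≤ 1 := by
  have hMpos : 0 < M := by
    have e1 := norm_nonneg (p - (c₀ + M • fun μ => (a μ : ℝ)))
    have e2 := norm_nonneg (p - q)
    have e3 := norm_nonneg (q - (c₀ + M • fun μ => (b μ : ℝ)))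
    linarith
  apply supDist_le_one_of_abs_lt_two
  intro μ
  have h1 : |p μ - (c₀ μ + M * a μ)| ≤ R₁ := by
    have e := norm_le_pi_norm (p - (c₀ + M • fun μ => (a μ : ℝ))) μ
    rw [Real.norm_eq_abs] at e
    simp only [Pi.sub_apply, Pi.add_apply, Pi.smul_apply, smul_eq_mul] at e
    exact e.trans hp
  have h2 : |p μ - q μ| ≤ ρ := by
    have e := norm_le_pi_norm (p - q) μ
    rw [Real.norm_eq_abs] at e
    exact e.trans hpq
  have h3 : |q μ - (c₀ μ + M * b μ)| ≤ R₂ := by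
    have e := norm_le_pi_norm (q - (c₀ + M • fun μ => (b μ : ℝ))) μ
    rw [Real.norm_eq_abs] at e
    simp only [Pi.sub_apply, Pi.add_apply, Pi.smul_apply, smul_eq_mul] at e
    exact e.trans hq
  have h4 : |M * (a μ : ℝ) - M * b μ| < 2 * M := by
    calc |M * (a μ : ℝ) - M * b μ|
        = |((c₀ μ + M * a μ) - p μ) + (p μ - q μ) + (q μ - (c₀ μ + M * b μ))| := by ring_nf
      _ ≤ |(c₀ μ + M * a μ) - p μ| + |p μ - q μ| + |q μ - (c₀ μ + M * b μ)| := abs_add_three _ _ _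
      _ ≤ R₁ + ρ + R₂ := by rw [abs_sub_comm] at h1; linarith
      _ < 2 * M := hM
  rw [← mul_sub, abs_mul, abs_of_pos hMpos, mul_comm 2 M] at h4
  exact lt_of_mul_lt_mul_left h4 hMpos.le

/-- the cube of the lattice `c₀ + Mℤ^ι` containing a point, by coordinatewise ROUNDING: its centre is within `M∕2` in the sup
metric. [cite: Dimock2004QED3TorusII, §3.2 (132) p.22 L10–11 («ω : x → y means x ∈ □̃_0, y ∈ □̃_n»)] -/
theorem norm_sub_round_le {c₀ : ι → ℝ} {M : ℝ} (hM : 0 < M) (p : ι → ℝ) :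
    ‖p - (c₀ + M • fun μ => ((round ((p μ - c₀ μ) / M) : ℤ) : ℝ))‖ ≤ M / 2 := by
  refine (pi_norm_le_iff_of_nonneg (by positivity)).2 fun μ => ?_
  rw [Real.norm_eq_abs]
  simp only [Pi.sub_apply, Pi.add_apply, Pi.smul_apply, smul_eq_mul]
  have h := abs_sub_round ((p μ - c₀ μ) / M)
  have e : p μ - (c₀ μ + M * (round ((p μ - c₀ μ) / M) : ℝ))
      = M * ((p μ - c₀ μ) / M - round ((p μ - c₀ μ) / M)) := by
    rw [mul_sub, mul_div_cancel₀ _ hM.ne']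
    ring
  rw [e, abs_mul, abs_of_pos hM]
  calc M * |(p μ - c₀ μ) / M - round ((p μ - c₀ μ) / M)| ≤ M * (1 / 2) := mul_le_mul_of_nonneg_left h hM.le
    _ = M / 2 := by ring

variable {X : Type*} {E : Type*} [Ring E]
variable {Z : Type*} {φ : Z → X → E}
variable {pos : X → ι → ℝ} {c₀ : ι → ℝ} {M R ρ R₀ : ℝ} {cidx : Z → ι → ℤ} {A : Matrix X X E}

/-- a cube meeting `x` through `supp h_□ ∋ x` is within index distance `1` of the cube of `x` (any index map `sidx` whose
centres are within `R₀` of the sites, `R₀ + R < 2M`). [cite: Dimock2004QED3TorusII, §3.2 (132) p.22 L10–11 and Thm 1 proof Part I p.23 L55–56] -/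
theorem supDist_sidx_le_one (hφ : ∀ z x, φ z x ≠ 0 → ‖pos x - (c₀ + M • fun μ => (cidx z μ : ℝ))‖ ≤ R)
    {sidx : X → ι → ℤ} (hsidx : ∀ x, ‖pos x - (c₀ + M • fun μ => (sidx x μ : ℝ))‖ ≤ R₀) (hR₀ : R₀ + R < 2 * M)
    {z : Z} {x : X} (hx : φ z x ≠ 0) : supDist (sidx x) (cidx z) ≤ 1 := by
  have h0 : ‖pos x - pos x‖ ≤ 0 := by rw [sub_self, norm_zero]
  exact supDist_le_one_of_witness (by linarith : R₀ + 0 + R < 2 * M) (hsidx x) h0 (hφ z x hx)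

/-- a cube meeting an `A`-neighbour `u` of `x` through `supp h_□ ∋ u` is within index distance `1` of the cube of `x`
(`R₀ + ρ + R < 2M`). [cite: Dimock2004QED3TorusII, §3.2 (132) p.22 L10–11 and Thm 1 proof Part I p.23 L54–56] -/
theorem supDist_sidx_le_one_of_near (hφ : ∀ z x, φ z x ≠ 0 → ‖pos x - (c₀ + M • fun μ => (cidx z μ : ℝ))‖ ≤ R)
    (hA : ∀ x y, A x y ≠ 0 → ‖pos x - pos y‖ ≤ ρ)
    {sidx : X → ι → ℤ} (hsidx : ∀ x, ‖pos x - (c₀ + M • fun μ => (sidx x μ : ℝ))‖ ≤ R₀)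
    (hR₀ : R₀ + ρ + R < 2 * M) {z : Z} {x u : X} (hxu : A x u ≠ 0) (hu : φ z u ≠ 0) :
    supDist (sidx x) (cidx z) ≤ 1 :=
  supDist_le_one_of_witness hR₀ (hsidx x) (hA x u hxu) (hφ z u hu)

variable [Fintype X] [DecidableEq X] {H : Z → Matrix X X E}

/-- **`h_□R_{□′} = 0` unless `□, □′` are adjacent** (index sup-distance `≤ 1`: *"touch, possibly only on corners, …
including `□_j = □_{j+1}`"*), for `supp h_□` within sup-radius `R` of the centre `c₀ + M·cidx □` («`supp h_□ ⊂ □̃`») and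
`A` of range `ρ`, when `2R + ρ < 2M` — the hypothesis `hadj` of the tree's `dimock_thm1`.
[cite: Dimock2004QED3TorusII, §3.2 Thm 1 proof Part I p.23 L54–55 with §3.1 (126) p.21 L11–15 and (132) p.22 L7–11] -/
theorem H_mul_Kz_eq_zero_of_far (hH : ∀ z, H z = Matrix.diagonal (φ z))
    (hφ : ∀ z x, φ z x ≠ 0 → ‖pos x - (c₀ + M • fun μ => (cidx z μ : ℝ))‖ ≤ R)
    (hA : ∀ x y, A x y ≠ 0 → ‖pos x - pos y‖ ≤ ρ) (hRρ : 2 * R + ρ < 2 * M)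
    {z z' : Z} (hfar : ¬ supDist (cidx z) (cidx z') ≤ 1) : H z * Kz A H z' = 0 := by
  apply H_mul_Kz_eq_zero hH
  intro x y hx hAxy
  have hρ0 : 0 ≤ ρ := (norm_nonneg _).trans (hA x y hAxy)
  by_contra hcon
  apply hfar
  rcases not_and_or.1 hcon with h | h
  · have h0 : ‖pos x - pos x‖ ≤ 0 := by rw [sub_self, norm_zero]
    exact supDist_le_one_of_witness (by linarith : R + 0 + R < 2 * M) (hφ z x hx) h0 (hφ z' x h)
  · exact supDist_le_one_of_witness (by linarith : R + ρ + R < 2 * M) (hφ z x hx) (hA x y hAxy) (hφ z' y h)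

/-- **«`h_□h_□′ = 0` unless `□, □′` touch»**: supports within sup-radius `R < M` of centres `2M` apart in some coordinate
are disjoint. [cite: Dimock2004QED3TorusII, §3.1 p.21 L10] -/
theorem H_mul_H_eq_zero_of_far (hH : ∀ z, H z = Matrix.diagonal (φ z))
    (hφ : ∀ z x, φ z x ≠ 0 → ‖pos x - (c₀ + M • fun μ => (cidx z μ : ℝ))‖ ≤ R) (hRM : R < M)
    {z z' : Z} (hfar : ¬ supDist (cidx z) (cidx z') ≤ 1) : H z * H z' = 0 := by
  apply H_mul_H_eq_zero hH
  intro x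
  by_contra hcon
  obtain ⟨h1, h2⟩ := not_or.1 hcon
  have h0 : ‖pos x - pos x‖ ≤ 0 := by rw [sub_self, norm_zero]
  exact hfar (supDist_le_one_of_witness (by linarith : R + 0 + R < 2 * M) (hφ z x h1) h0 (hφ z' x h2))

/-- **the first link at `x` lives on the cubes next to the cube of `x`**: `(h_□S*_□h_□)(x,·) = 0` unless
`supDist (sidx x) (cidx □) ≤ 1` — the hypotheses `hS₀`, `hS₀near` of the tree's `dimock_thm1(_lattice)`.
[cite: Dimock2004QED3TorusII, §3.2 Thm 1 proof Part I p.23 L55–56 («vanishes unless x ∈ supp h_{□_0} ⊂ □̃_0»)] -/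
theorem link0_eq_zero_of_far (hH : ∀ z, H z = Matrix.diagonal (φ z))
    (hφ : ∀ z x, φ z x ≠ 0 → ‖pos x - (c₀ + M • fun μ => (cidx z μ : ℝ))‖ ≤ R)
    {sidx : X → ι → ℤ} (hsidx : ∀ x, ‖pos x - (c₀ + M • fun μ => (sidx x μ : ℝ))‖ ≤ R₀) (hR₀ : R₀ + R < 2 * M)
    (G : Z → Matrix X X E) {z : Z} {x : X} (hfar : ¬ supDist (sidx x) (cidx z) ≤ 1) (v : X) :
    link0 H G z x v = 0 := by
  refine link0_eq_zero_of_apply hH G ?_ v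
  by_contra hx
  exact hfar (supDist_sidx_le_one hφ hsidx hR₀ hx)

/-- **a later link at `x` lives on the cubes next to the cube of `x`**: `(R_□S*_□h_□)(x,·) = 0` unless
`supDist (sidx x) (cidx □) ≤ 1` — the hypotheses `hS₁`, `hS₁near` of the tree's `dimock_thm1(_lattice)`.
[cite: Dimock2004QED3TorusII, §3.2 Thm 1 proof Part I (140)–(142) p.23 L18–56] -/
theorem linkR_eq_zero_of_far (hH : ∀ z, H z = Matrix.diagonal (φ z))
    (hφ : ∀ z x, φ z x ≠ 0 → ‖pos x - (c₀ + M • fun μ => (cidx z μ : ℝ))‖ ≤ R)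
    (hA : ∀ x y, A x y ≠ 0 → ‖pos x - pos y‖ ≤ ρ)
    {sidx : X → ι → ℤ} (hsidx : ∀ x, ‖pos x - (c₀ + M • fun μ => (sidx x μ : ℝ))‖ ≤ R₀)
    (hR₀ : R₀ + R < 2 * M) (hR₀' : R₀ + ρ + R < 2 * M)
    (G : Z → Matrix X X E) {z : Z} {x : X} (hfar : ¬ supDist (sidx x) (cidx z) ≤ 1) (v : X) :
    linkR A H G z x v = 0 := by
  refine linkR_eq_zero_of hH G ?_ (fun u hxu => ?_) v
  · by_contra hx
    exact hfar (supDist_sidx_le_one hφ hsidx hR₀ hx)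
  · by_contra hu
    exact hfar (supDist_sidx_le_one_of_near hφ hA hsidx hR₀' hxu hu)

end Supports

section Endpoints

variable {ι : Type*} [Fintype ι]
variable {X : Type*} [Fintype X] [DecidableEq X] {E : Type*} [NormedRing E]
variable {Z : Type*} {φ : Z → X → E} {H : Z → Matrix X X E}
variable {pos : X → ι → ℝ} {c₀ : ι → ℝ} {M R : ℝ} {cidx : Z → ι → ℤ} {A : Matrix X X E}

/-- **«the notation `ω : x → y` means `x ∈ □̃_0`, `y ∈ □̃_n`»**: a non-zero entry `S_ω(x,y)` forces `x` within `R` of the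
centre of `□_0` and `y` within `R` of the centre of `□_n`.
[cite: Dimock2004QED3TorusII, §3.2 (132) p.22 L10–11 and Thm 1 proof Part I p.23 L55–56] -/
theorem chainProd_ne_zero_endpoints (hH : ∀ z, H z = Matrix.diagonal (φ z))
    (hφ : ∀ z x, φ z x ≠ 0 → ‖pos x - (c₀ + M • fun μ => (cidx z μ : ℝ))‖ ≤ R)
    (G : Z → Matrix X X E) {n : ℕ} (ω : Fin (n + 1) → Z) {x y : X} (hne : chainProd A H G ω x y ≠ 0) :
    ‖pos x - (c₀ + M • fun μ => (cidx (ω 0) μ : ℝ))‖ ≤ R ∧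
      ‖pos y - (c₀ + M • fun μ => (cidx (ω (Fin.last n)) μ : ℝ))‖ ≤ R := by
  constructor
  · apply hφ
    intro hx
    exact hne (chainProd_apply_eq_zero_of_row A H G ω x y (link0_eq_zero_of_apply hH G hx))
  · apply hφ
    intro hy
    exact hne (chainProd_apply_eq_zero_of_last hH A G ω x hy)

end Endpoints

/-! ## §3 THEOREM 1, single scale, with the supports DERIVED -/

section Theorem1

variable {ι : Type*} [Fintype ι] [DecidableEq ι]
variable {X : Type*} [Fintype X] [DecidableEq X] {E : Type*} [NormedRing E] [NormedAlgebra ℝ E]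
variable {Z : Type*} [Fintype Z] [DecidableEq Z]
variable {B : Type*} [Fintype B] [DecidableEq B]

/-- **THEOREM 1 (132)–(135), single-scale member, locality DERIVED.**  The tree's `dimock_thm1_lattice` with the cube
adjacency `adj □ □′ := supDist (cidx □) (cidx □′) ≤ 1` and its hypotheses `hadj` (`h_□R_{□′} = 0` off adjacency), `S₀`,
`hS₀`, `hS₀near`, `S₁`, `hS₁`, `hS₁near` (both kinds of links at a site start on the `≤ 3^{|ι|}` cubes next to the cube of the
site) DISCHARGED from: `H □ = diagonal(h_□)` a multiplication operator with `supp h_□` within sup-radius `R` of the centre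
`c₀ + M·cidx □` (positions `pos : X → ℝ^ι`), the operator `A` of finite range `ρ ≥ 0` (`A(x,y) ≠ 0 ⟹ ‖pos x − pos y‖ ≤ ρ`),
and `2R + ρ < 2M`, `R + ρ < 3M∕2`.  Remaining hypotheses and conclusions exactly as in `dimock_thm1_lattice`.
[cite: Dimock2004QED3TorusII, §3.2 Thm 1 (132)–(135) p.22 L2–21, Remark 3 p.22 L28–30, proof Part I (138)–(142) p.23 L1–58, Part III p.24 L59 – p.25 L12; §3.1 (124)–(126) p.20 L82 – p.21 L15] -/
theorem dimock_thm1_supported [CompleteSpace E] {θ c : ℝ} {P₀ Q : X → X → ℝ} {blk : X → B} {ctr : B → X}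
    (e : X → (ι → ℤ)) (idx : B → (ι → ℤ)) (hidx : Function.Injective idx) (u₀ : ι → ℤ) {s : ℕ} (hs : 1 ≤ s)
    (hctr : ∀ b, e (ctr b) = u₀ + s • idx b) {h : ℕ} (hcentre : ∀ u, supDist (e u) (e (ctr (blk u))) ≤ h)
    (cidx : Z → (ι → ℤ)) (hcidx : Function.Injective cidx)
    {w' : ℝ} (hw' : 0 < w') (hθ : 0 ≤ θ) (hc : 0 < c) (hQ0 : ∀ u v, 0 ≤ Q u v) (hP₀0 : ∀ u v, 0 ≤ P₀ u v)
    (hconv : ∀ (b : B) (u v : X),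
      ∑ y ∈ univ.filter (fun u => blk u = b), (1 : ℝ) * (Q u y * Q y v) ≤ θ * Q u v)
    (hconv₀ : ∀ (b : B) (u v : X),
      ∑ y ∈ univ.filter (fun u => blk u = b), (1 : ℝ) * (P₀ u y * Q y v) ≤ θ * P₀ u v)
    (φ : Z → X → E) (H : Z → Matrix X X E) (hH : ∀ z, H z = Matrix.diagonal (φ z))
    (pos : X → ι → ℝ) (c₀ : ι → ℝ) {M R ρ : ℝ} (hM : 0 < M)
    (hφ : ∀ z x, φ z x ≠ 0 → ‖pos x - (c₀ + M • fun μ => (cidx z μ : ℝ))‖ ≤ R)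
    (A : Matrix X X E) (hA : ∀ x y, A x y ≠ 0 → ‖pos x - pos y‖ ≤ ρ) (hρ0 : 0 ≤ ρ)
    (hRρ : 2 * R + ρ < 2 * M) (hRρ' : R + ρ < 3 * M / 2)
    (G : Z → Matrix X X E) (h125 : ∑ z, H z * H z = 1) (h136 : ∀ z, H z * A * G z = H z)
    {C₀ C₁ M₀ : ℝ} (hC₀ : 0 ≤ C₀) (hC₁ : 0 ≤ C₁) (hM₀ : 0 < M₀)
    (h0 : ∀ z u v, ‖link0 H G z u v‖
      ≤ C₀ * (P₀ u v * Real.exp (-(c * pathDist (fun _ => w') (e u) (e v)))))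
    (hR : ∀ z u v, ‖linkR A H G z u v‖
      ≤ C₁ / M₀ * (Q u v * Real.exp (-(c * pathDist (fun _ => w') (e u) (e v)))))
    (hlarge : 2 * (((3 ^ Fintype.card ι : ℕ) : ℝ) *
        (C₁ * θ * (2 / (1 - Real.exp (-(c / 2 * (w' * s) / Fintype.card ι)))) ^ Fintype.card ι
          * Real.exp (2 * c * (w' * h)))) ≤ M₀) :
    (∀ x y, Summable fun n => (Gstar H G * Kop A H G ^ n) x y) ∧
    A * walkExpansion A H G = 1 ∧
    ∀ x y, ‖walkExpansion A H G x y‖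
      ≤ 2 * ((3 ^ Fintype.card ι : ℕ) : ℝ) * (C₀ * Real.exp (3 * c * (w' * h)))
        * (P₀ x y * Real.exp (-(c / 2) * pathDist (fun _ => w') (e x) (e y))) := by
  classical
  -- the cube of a site, by rounding: centre within `M∕2`
  let sidx : X → ι → ℤ := fun x μ => round ((pos x μ - c₀ μ) / M)
  have hsidx : ∀ x, ‖pos x - (c₀ + M • fun μ => (sidx x μ : ℝ))‖ ≤ M / 2 := fun x => norm_sub_round_le hM (pos x)
  have hR₀ : M / 2 + R < 2 * M := by linarith
  have hR₀' : M / 2 + ρ + R < 2 * M := by linarith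
  -- the start cubes of a site: those within index distance 1 of its cube
  let S : X → Finset Z := fun x => univ.filter fun z => supDist (sidx x) (cidx z) ≤ 1
  have hSfar : ∀ x, ∀ z ∉ S x, ¬ supDist (sidx x) (cidx z) ≤ 1 :=
    fun x z hz hle => hz (mem_filter.2 ⟨mem_univ _, hle⟩)
  have hSnear : ∀ x, ∀ z ∈ S x, supDist (sidx x) (cidx z) ≤ 1 := fun x z hz => (mem_filter.1 hz).2
  exact dimock_thm1_lattice (fun z z' => supDist (cidx z) (cidx z') ≤ 1) e idx hidx u₀ hs hctr hcentre cidx hcidx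
    (fun _ _ hzz' => hzz') sidx hw' hθ hc hQ0 hP₀0 hconv hconv₀ A H G h125 h136 hC₀ hC₁ hM₀ h0 hR
    (fun _ _ hzz' => H_mul_Kz_eq_zero_of_far hH hφ hA hRρ hzz')
    S (fun x z hz v => link0_eq_zero_of_far hH hφ hsidx hR₀ G (hSfar x z hz) v) hSnear
    S (fun x z hz v => linkR_eq_zero_of_far hH hφ hA hsidx hR₀ hR₀' G (hSfar x z hz) v) hSnear hlarge

/-! ## §4 THEOREM 1 with `h_□ :=` the printed (124), and (125) on the finite site set -/

open QED3SquarePartition (hBlock hBlock_eq_zero eq125)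

omit [DecidableEq ι] in
/-- the support of the printed `h_□` (124) with the tree's CONSTRUCTED `g` (`QED3SquarePartitionOfUnity`): for the cube of
side `M` centred at `y`, `h_□(p) = g(M^{−1}(p − y)) ≠ 0 ⟹ ‖p − y‖ ≤ 2M∕3` («`supp h_□ ⊂ □̃`», sup metric).
[cite: Dimock2004QED3TorusII, §3.1 (124), (126) p.20 L82 – p.21 L15] -/
theorem norm_le_of_hBlock_ne_zero {M : ℝ} (hM : 0 < M) {y p : ι → ℝ} (h : hBlock M⁻¹ y p ≠ 0) :
    ‖p - y‖ ≤ 2 * M / 3 := by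
  by_contra hlt
  rw [not_le] at hlt
  apply h
  apply hBlock_eq_zero (inv_pos.2 hM)
  calc (2 : ℝ) / 3 = M⁻¹ * (2 * M / 3) := by field_simp
    _ < M⁻¹ * ‖p - y‖ := mul_lt_mul_of_pos_left hlt (inv_pos.2 hM)

omit [DecidableEq ι] [Fintype X] [DecidableEq X] [Fintype Z] [DecidableEq Z] in
/-- the same for `h_□` as a multiplication operator with values in `E` (via `algebraMap ℝ E`): `h_□(x) ≠ 0 ⟹
‖pos x − centre(□)‖ ≤ 2M∕3`. [cite: Dimock2004QED3TorusII, §3.1 (124), (126) p.20 L82 – p.21 L15] -/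
theorem hBlock_support {pos : X → ι → ℝ} {c₀ : ι → ℝ} {M : ℝ} (hM : 0 < M) {cidx : Z → ι → ℤ} (z : Z) (x : X)
    (hx : algebraMap ℝ E (hBlock M⁻¹ (c₀ + M • fun μ => (cidx z μ : ℝ)) (pos x)) ≠ 0) :
    ‖pos x - (c₀ + M • fun μ => (cidx z μ : ℝ))‖ ≤ 2 * M / 3 :=
  norm_le_of_hBlock_ne_zero hM fun h0 => hx (by rw [h0, map_zero])

omit [DecidableEq ι] [DecidableEq Z] in
/-- **(125) `Σ_□h_□(x)² = 1` on a finite cube array, for `x` well inside it**: if every cube of the lattice `c₀ + Mℤ^ι`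
whose centre is within `2M∕3` of the point `p` belongs to the array (`cidx : Z → ℤ^ι` injective), then
`Σ_{□∈Z}h_□(p)² = 1` — *"Then for `x` well inside `⋃_{□∈D_i}□` `Σ_{□∈D}h_□(x)² = 1` (125)"*; from the tree's `eq125`
(the identity over all of `ℤ^ι`) by dropping the vanishing terms. [cite: Dimock2004QED3TorusII, §3.1 (125) p.20 L85 – p.21 L4] -/
theorem sum_hBlock_sq_eq_one (c₀ : ι → ℝ) {M : ℝ} (hM : 0 < M) (cidx : Z → ι → ℤ)
    (hcidx : Function.Injective cidx) (p : ι → ℝ)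
    (hcover : ∀ n : ι → ℤ, ‖p - (c₀ + M • fun μ => (n μ : ℝ))‖ ≤ 2 * M / 3 → ∃ z, cidx z = n) :
    ∑ z, hBlock M⁻¹ (c₀ + M • fun μ => (cidx z μ : ℝ)) p ^ 2 = 1 := by
  classical
  have h1 := eq125 (inv_ne_zero hM.ne') c₀ p
  rw [inv_inv] at h1
  have hzero : ∀ n ∉ (univ : Finset Z).map ⟨cidx, hcidx⟩,
      hBlock M⁻¹ (c₀ + M • fun μ => (n μ : ℝ)) p ^ 2 = 0 := by
    intro n hn
    have h0 : hBlock M⁻¹ (c₀ + M • fun μ => (n μ : ℝ)) p = 0 := by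
      by_contra hne
      obtain ⟨z, hz⟩ := hcover n (norm_le_of_hBlock_ne_zero hM hne)
      exact hn (mem_map.2 ⟨z, mem_univ _, hz⟩)
    rw [h0, zero_pow two_ne_zero]
  have h2 := h1.unique (hasSum_sum_of_ne_finset_zero hzero)
  rw [sum_map] at h2
  exact h2.symm

omit [DecidableEq ι] [DecidableEq Z] in
/-- **(125) as the operator identity `Σ_□h_□h_□ = 1`** (the hypothesis `h125` of the tree's `dimock_thm1`) for the
multiplication operators `H □ = diagonal(h_□)`, `h_□ := (124)`, on a finite site set every site of which is well inside the
cube array. [cite: Dimock2004QED3TorusII, §3.1 (125) p.20 L85 – p.21 L4 and §3.2 Thm 1 proof Part I (139) p.23 L9–17 («thanks to (125) and (136)»)] -/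
theorem h125_hBlock (pos : X → ι → ℝ) (c₀ : ι → ℝ) {M : ℝ} (hM : 0 < M) (cidx : Z → ι → ℤ)
    (hcidx : Function.Injective cidx) (H : Z → Matrix X X E)
    (hH : ∀ z, H z = Matrix.diagonal fun x =>
      algebraMap ℝ E (hBlock M⁻¹ (c₀ + M • fun μ => (cidx z μ : ℝ)) (pos x)))
    (hcover : ∀ (x : X) (n : ι → ℤ), ‖pos x - (c₀ + M • fun μ => (n μ : ℝ))‖ ≤ 2 * M / 3 → ∃ z, cidx z = n) :
    ∑ z, H z * H z = 1 := by
  have e : ∀ z, H z * H z = Matrix.diagonal fun x =>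
      algebraMap ℝ E (hBlock M⁻¹ (c₀ + M • fun μ => (cidx z μ : ℝ)) (pos x) ^ 2) := by
    intro z
    rw [hH z, Matrix.diagonal_mul_diagonal]
    congr 1
    funext x
    rw [← map_mul, sq]
  simp_rw [e]
  ext i j
  rw [Matrix.sum_apply, Matrix.one_apply]
  simp_rw [Matrix.diagonal_apply]
  split_ifs with hij
  · rw [← map_sum, sum_hBlock_sq_eq_one c₀ hM cidx hcidx (pos i) (hcover i), map_one]
  · exact sum_const_zero

/-- **THEOREM 1 (132)–(135), single-scale member, with `h_□ := (124)` and (125) DERIVED.**  `dimock_thm1_supported` for the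
multiplication operators `H □ = diagonal(x ↦ g(M^{−1}(pos x − (c₀ + M·cidx □))))` — the printed
`h_□(x) = g((x − y)L^{k−i}∕M₀)` with the tree's constructed `g`, `M = M₀L^{−(k−i)}` the cube side, `y = c₀ + M·cidx □` its
centre: the support radius is `R = 2M∕3` (`hBlock_support`), (125) `Σ_□h_□² = 1` holds because every site is *"well
inside"* the cube array (`hcover`: every lattice cube with centre within `2M∕3` of a site is a cube of `Z`; `h125_hBlock`),
and the only condition on `A` besides (136) and the link bounds is the RANGE condition `0 ≤ ρ < 2M∕3` (for the printed
operator `ρ = L^{−(k−i)}`, i.e. `M₀ > 3∕2`: *"Let `M₀` be sufficiently large"*).  (136), (137) ∕ (143), (154) remain the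
hypotheses `h136`, `h0`, `hR`, `hconv`, `hconv₀`.
[cite: Dimock2004QED3TorusII, §3.2 Thm 1 (132)–(135) p.22 L2–21, Remark 3 p.22 L28–30, proof Part I (138)–(142) p.23 L1–58; §3.1 (124)–(126) p.20 L82 – p.21 L15] -/
theorem dimock_thm1_hBlock [CompleteSpace E] {θ c : ℝ} {P₀ Q : X → X → ℝ} {blk : X → B} {ctr : B → X}
    (e : X → (ι → ℤ)) (idx : B → (ι → ℤ)) (hidx : Function.Injective idx) (u₀ : ι → ℤ) {s : ℕ} (hs : 1 ≤ s)
    (hctr : ∀ b, e (ctr b) = u₀ + s • idx b) {h : ℕ} (hcentre : ∀ u, supDist (e u) (e (ctr (blk u))) ≤ h)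
    (cidx : Z → (ι → ℤ)) (hcidx : Function.Injective cidx)
    {w' : ℝ} (hw' : 0 < w') (hθ : 0 ≤ θ) (hc : 0 < c) (hQ0 : ∀ u v, 0 ≤ Q u v) (hP₀0 : ∀ u v, 0 ≤ P₀ u v)
    (hconv : ∀ (b : B) (u v : X),
      ∑ y ∈ univ.filter (fun u => blk u = b), (1 : ℝ) * (Q u y * Q y v) ≤ θ * Q u v)
    (hconv₀ : ∀ (b : B) (u v : X),
      ∑ y ∈ univ.filter (fun u => blk u = b), (1 : ℝ) * (P₀ u y * Q y v) ≤ θ * P₀ u v)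
    (pos : X → ι → ℝ) (c₀ : ι → ℝ) {M ρ : ℝ} (hM : 0 < M) (H : Z → Matrix X X E)
    (hH : ∀ z, H z = Matrix.diagonal fun x =>
      algebraMap ℝ E (hBlock M⁻¹ (c₀ + M • fun μ => (cidx z μ : ℝ)) (pos x)))
    (hcover : ∀ (x : X) (n : ι → ℤ), ‖pos x - (c₀ + M • fun μ => (n μ : ℝ))‖ ≤ 2 * M / 3 → ∃ z, cidx z = n)
    (A : Matrix X X E) (hA : ∀ x y, A x y ≠ 0 → ‖pos x - pos y‖ ≤ ρ) (hρ0 : 0 ≤ ρ) (hρM : ρ < 2 * M / 3)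
    (G : Z → Matrix X X E) (h136 : ∀ z, H z * A * G z = H z)
    {C₀ C₁ M₀ : ℝ} (hC₀ : 0 ≤ C₀) (hC₁ : 0 ≤ C₁) (hM₀ : 0 < M₀)
    (h0 : ∀ z u v, ‖link0 H G z u v‖
      ≤ C₀ * (P₀ u v * Real.exp (-(c * pathDist (fun _ => w') (e u) (e v)))))
    (hR : ∀ z u v, ‖linkR A H G z u v‖
      ≤ C₁ / M₀ * (Q u v * Real.exp (-(c * pathDist (fun _ => w') (e u) (e v)))))
    (hlarge : 2 * (((3 ^ Fintype.card ι : ℕ) : ℝ) *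
        (C₁ * θ * (2 / (1 - Real.exp (-(c / 2 * (w' * s) / Fintype.card ι)))) ^ Fintype.card ι
          * Real.exp (2 * c * (w' * h)))) ≤ M₀) :
    (∀ x y, Summable fun n => (Gstar H G * Kop A H G ^ n) x y) ∧
    A * walkExpansion A H G = 1 ∧
    ∀ x y, ‖walkExpansion A H G x y‖
      ≤ 2 * ((3 ^ Fintype.card ι : ℕ) : ℝ) * (C₀ * Real.exp (3 * c * (w' * h)))
        * (P₀ x y * Real.exp (-(c / 2) * pathDist (fun _ => w') (e x) (e y))) :=
  dimock_thm1_supported e idx hidx u₀ hs hctr hcentre cidx hcidx hw' hθ hc hQ0 hP₀0 hconv hconv₀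
    (fun z x => algebraMap ℝ E (hBlock M⁻¹ (c₀ + M • fun μ => (cidx z μ : ℝ)) (pos x))) H hH pos c₀ hM
    (fun z x hx => hBlock_support hM z x hx) A hA hρ0 (by linarith) (by linarith) G
    (h125_hBlock pos c₀ hM cidx hcidx H hH hcover) h136 hC₀ hC₁ hM₀ h0 hR hlarge

end Theorem1

/-! ## §5 (v1.1) The `A`-dependence clause of THEOREM 1: «`S_{k,Λ,ω}(A)` depends on `A` only in `⋃_{□∈ω}□^{(5)}`» -/

section ADependence

variable {X : Type*} [Fintype X] [DecidableEq X] {E : Type*} [Ring E]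
variable {Z : Type*} {φ : Z → X → E} {H : Z → Matrix X X E}

/-- **`R_□(A)` sees `A` only at `supp h_□`**: for a multiplication operator `h_□`, the commutator link `R_□ = h_□A − Ah_□`
(the tree's `Kz`, (140)) is unchanged when `A` is modified at entries `(x,y)` with BOTH `x, y ∉ supp h_□`.
[cite: Dimock2004QED3TorusII, §3.2 Thm 1 p.22 L22–23 («depends on `A` only in `⋃_{□∈ω}□^{(5)}`») with proof Part I (140) p.23 L18–25] -/
theorem Kz_congr (hH : ∀ z, H z = Matrix.diagonal (φ z)) {A A' : Matrix X X E} {z : Z}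
    (hAA' : ∀ x y, (φ z x ≠ 0 ∨ φ z y ≠ 0) → A x y = A' x y) : Kz A H z = Kz A' H z := by
  ext x y
  rw [Kz_apply hH, Kz_apply hH]
  by_cases hx : φ z x = 0
  · by_cases hy : φ z y = 0
    · rw [hx, hy, zero_mul, zero_mul, mul_zero, mul_zero]
    · rw [hAA' x y (Or.inr hy)]
  · rw [hAA' x y (Or.inl hx)]

/-- the first link `h_□S*_□(A)h_□` sees `A` only through `S*_□(A)`. [cite: Dimock2004QED3TorusII, §3.2 Thm 1 p.22 L22–23 with proof Part I (138), (142) p.23 L3–40] -/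
theorem link0_congr_of_eq {G G' : Z → Matrix X X E} {z : Z} (hG : G z = G' z) : link0 H G z = link0 H G' z := by
  show H z * G z * H z = H z * G' z * H z
  rw [hG]

/-- a later link `R_□(A)S*_□(A)h_□` sees `A` only through `S*_□(A)` and the entries of `A` touching `supp h_□`.
[cite: Dimock2004QED3TorusII, §3.2 Thm 1 p.22 L22–23 with proof Part I (140)–(142) p.23 L18–40] -/
theorem linkR_congr (hH : ∀ z, H z = Matrix.diagonal (φ z)) {A A' : Matrix X X E} {G G' : Z → Matrix X X E} {z : Z}
    (hAA' : ∀ x y, (φ z x ≠ 0 ∨ φ z y ≠ 0) → A x y = A' x y) (hG : G z = G' z) :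
    linkR A H G z = linkR A' H G' z := by
  show Kz A H z * G z * H z = Kz A' H z * G' z * H z
  rw [Kz_congr hH hAA', hG]

end ADependence

section ADependenceChain

variable {X : Type*} [Fintype X] [DecidableEq X] {E : Type*} [NormedRing E]
variable {Z : Type*} {φ : Z → X → E} {H : Z → Matrix X X E}

/-- **THE `A`-DEPENDENCE CLAUSE OF THEOREM 1** (p.22 L22–23: *"`S_{k,Λ,ω}(A)` depends on `A` only in `⋃_{□∈ω}□^{(5)}`"*),
for multiplication operators `h_□`: the path operator `S_{k,Λ,ω}(A) = (h_{□_0}S*_{□_0}(A)h_{□_0})Π_j(R_{□_j}(A)S*_{□_j}(A)h_{□_j})`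
(the tree's `chainProd`) is UNCHANGED when (i) the local inverses of the cubes of `ω` are unchanged (`S*_{□_j}(A) =
S*_{□_j}(A′)` — LEMMA 2's locality «`S*_□(A)` depends on `A` in `□^{(5)}`», taken as the hypothesis `hG`) and (ii) `A` and
`A′` agree at every entry `(x,y)` with `x` or `y` in `⋃_j supp h_{□_j}` (`⊂ ⋃_j □̃_j ⊂ ⋃_j □_j^{(5)}`, (126)).
[cite: Dimock2004QED3TorusII, §3.2 Thm 1 p.22 L22–23, proof Part I (140)–(142) p.23 L18–40; §3.1 (126) p.21 L11–15] -/
theorem chainProd_congr_of_agree (hH : ∀ z, H z = Matrix.diagonal (φ z)) {A A' : Matrix X X E}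
    {G G' : Z → Matrix X X E} {n : ℕ} (ω : Fin (n + 1) → Z) (hG : ∀ j, G (ω j) = G' (ω j))
    (hAA' : ∀ j x y, (φ (ω j) x ≠ 0 ∨ φ (ω j) y ≠ 0) → A x y = A' x y) :
    chainProd A H G ω = chainProd A' H G' ω := by
  unfold chainProd
  have hfun : (fun j : Fin n => linkR A H G (ω j.succ)) = fun j => linkR A' H G' (ω j.succ) :=
    funext fun j => linkR_congr hH (hAA' j.succ) (hG j.succ)
  rw [link0_congr_of_eq (H := H) (hG 0), hfun]

variable {ι : Type*} [Fintype ι] [NormedAlgebra ℝ E]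

open QED3SquarePartition (hBlock)

/-- **The clause with `h_□ :=` the printed (124)** (`h_□(x) = g(M^{−1}(pos x − centre(□)))`, support in the sup-ball of
radius `2M∕3` about the centre — `hBlock_support`): `S_{k,Λ,ω}(A) = S_{k,Λ,ω}(A′)` as soon as the local inverses of the
cubes of `ω` agree and `A`, `A′` agree at every entry `(x,y)` with `pos x` or `pos y` within `2M∕3` of the centre of some
cube of `ω` — i.e. `S_{k,Λ,ω}(A)` depends on `A` only in `⋃_{□∈ω}□̃` beyond the dependence through the `S*_□(A)`, `□ ∈ ω`.
[cite: Dimock2004QED3TorusII, §3.2 Thm 1 p.22 L22–23; §3.1 (124), (126) p.20 L82 – p.21 L15] -/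
theorem chainProd_hBlock_congr (pos : X → ι → ℝ) (c₀ : ι → ℝ) {M : ℝ} (hM : 0 < M) (cidx : Z → ι → ℤ)
    (H : Z → Matrix X X E)
    (hH : ∀ z, H z = Matrix.diagonal fun x =>
      algebraMap ℝ E (hBlock M⁻¹ (c₀ + M • fun μ => (cidx z μ : ℝ)) (pos x)))
    {A A' : Matrix X X E} {G G' : Z → Matrix X X E} {n : ℕ} (ω : Fin (n + 1) → Z)
    (hG : ∀ j, G (ω j) = G' (ω j))
    (hAA' : ∀ j x y, (‖pos x - (c₀ + M • fun μ => (cidx (ω j) μ : ℝ))‖ ≤ 2 * M / 3 ∨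
      ‖pos y - (c₀ + M • fun μ => (cidx (ω j) μ : ℝ))‖ ≤ 2 * M / 3) → A x y = A' x y) :
    chainProd A H G ω = chainProd A' H G' ω := by
  refine chainProd_congr_of_agree
    (φ := fun z x => algebraMap ℝ E (hBlock M⁻¹ (c₀ + M • fun μ => (cidx z μ : ℝ)) (pos x))) hH ω hG ?_
  intro j x y hxy
  refine hAA' j x y ?_
  rcases hxy with h | h
  · exact Or.inl (hBlock_support hM (ω j) x h)
  · exact Or.inr (hBlock_support hM (ω j) y h)

end ADependenceChain

end QED3TorusII

end Literature.MathematicalPhysics.QuantumFieldTheory.Dimock2011to13
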